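import Literature.NumberTheory.PAdicHodge.FormalGroupDivisionHeightOne
import Literature.NumberTheory.PAdicHodge.AinfWeierstrassRamifiedCellsOrdinary
import Literature.NumberTheory.PAdicHodge.AinfWeierstrassTateModuleGeomO
import Literature.NumberTheory.EllipticCurves.TorsionPointsAlgebraic
import HarnessLib

/-!
# Formal `p`-power division towers of ALGEBRAIC points at ORDINARY reduction (height one): `E₁(ℂ_F)` and `E(F̄) ∩ E₁` are
# `p`-divisible, and every `P ∈ E(F̄)` with `P ∈ E₁(ℂ_F)` has a division sequence of `F̄`-points lying in `E₁(ℂ_F)`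

Topic `Literature/NumberTheory/PAdicHodge`; namespace `Literature.NumberTheory.PAdicHodge.AinfTop`. THEOREMS ONLY (no definition, no named fact, no
instance, no `sorry`). The ORDINARY replacement of `KummerCocycleMatchingO.geomToCO_divSeq_mem_kernel` (at good SUPERSINGULAR reduction EVERY
division sequence of a formal point is formal, `E[p^∞](ℂ_F) ⊂ E₁(ℂ_F)`; at ORDINARY reduction this fails — the formal group has height one and
`E[p] ⊄ E₁` — but a formal division sequence can be CHOSEN). For an `𝒪_F`-model `W` over `LTCoeff F` whose multiplication-by-`p` series has
`[Xᵖ][p]_W` a unit in `𝒪_{ℂ_F}` (height one; on the K★ cells from `A_p(W mod 𝔪_F) ≠ 0`,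
`AinfWeierstrassRamifiedCellsOrdinary.isUnit_algebraMap_coeff_prime_formalMul_of_hasseCoeff_red_ne_zero`):

* §1 `exists_nsmul_prime_eq_pt` — **`Ŵ(𝔪_{ℂ_F})` is `p`-divisible** as a group (`FormalGroupDivisionHeightOne.exists_evalPt₁_formalMul_prime_eq`:
  `[p]_W` is onto, + `Pt.val_nsmul`: `p • Q = [p]_W(Q)`); `exists_mem_kernel_nsmul_prime_eq` — **`E₁(ℂ_F)` is `p`-divisible** (AEC VII.2.2
  `ptHom : Ŵ(𝔪) ≃ E₁`).
* §2 `exists_geomToCO_eq_of_nsmul_eq_geomToCO` — **a `p`-th root in `E(ℂ_F)` of an `F̄`-point is an `F̄`-point** (its difference with an algebraic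
  `p`-th root is `p`-torsion, and torsion points are algebraic: `TorsionPointsAlgebraic.exists_mapPointHom_eq_of_zsmul_eq_zero`);
  ★ `exists_geom_nsmul_prime_eq_of_geomToCO_mem_kernel` — for `P ∈ E(F̄)` with `P ∈ E₁(ℂ_F)` there is `Q ∈ E(F̄)`, `p • Q = P`, `Q ∈ E₁(ℂ_F)`.
* §3 ★★ `exists_divSeq_geomToCO_mem_kernel` — **a `p`-power division sequence `Q : ℕ → E(F̄)`, `Q 0 = P`, `p • Q (n+1) = Q n`, ALL in
  `E₁(ℂ_F)`** (recursion on §2) — exactly the data `(Q, hQ, hker)` consumed by `FormalTateModuleInclusion.tateModuleOfPt_kummerCocycleO` (LEAD B2 §3: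
  `ι(κ_u σ) = (σQₙ − Qₙ)ₙ` for the formal Kummer cocycle `κ_u`, `uₙ = z(Qₙ)`) and by the ordinary twins of `…TransportedReciprocity(AllPoints)`;
  `exists_divSeq_geomToCO_mem_kernel_of_hasseCoeff_ne_zero` — the same from the Hasse datum `A_p(W mod 𝔪_F) ≠ 0`.

Purpose: crux K★ `stmt-BirchSwinnertonDyer-22226` (route `EdixhovenFibreFiveSeven`, line `kato_lever`), stub `stub_localFormulaOrdinaryCells`, the
unit-root frame road (memo `Summits/…/Cruxes/StarredOptimalManinUnitFiveSeven/Lines/kato-lever-seam-rec-at-cells.md` §17, bricks B5/B3: «per-point: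
division tower u»). Infrastructure only; BSD / K★ are not proved by this; nothing about elliptic curves over number fields is proved here.

## References
* J. H. Silverman, *The Arithmetic of Elliptic Curves* (2009), IV.4.4, IV.7, Prop. VII.2.1–VII.2.2, III.§7. [SilvermanAEC2009]
* J. Tate, *p-divisible groups* (1967), §2.4, §4 (`0 → T_pÊ → T_pE → T_pE^{ét} → 0`). [Tate1967]
* R. Greenberg, *Iwasawa theory for elliptic curves*, LNM 1716 (1999), §1 p. 62 (`ker(E[p^∞] → Ẽ[p^∞]) ≅ ℚ_p/ℤ_p` at ordinary `p`). [GreenbergLNM1716]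
-/

noncomputable section

open scoped Classical

namespace Literature.NumberTheory.PAdicHodge

open Literature Literature.NumberTheory.GaloisRepresentations Literature.NumberTheory.EllipticCurves WeierstrassCurve
open Literature.NumberTheory.GaloisRepresentations.IsNonarchimedeanLocalField Field ValuativeRel
open Literature.NumberTheory.GaloisRepresentations.LubinTate Literature.NumberTheory.EllipticCurves.FormalGroupChart

namespace AinfTop

variable {F : Type} [Field F] [ValuativeRel F] [TopologicalSpace F] [IsNonarchimedeanLocalField F] [CharZero F]
  (W : WeierstrassCurve (LTCoeff F)) {p : ℕ} [Fact p.Prime] [IsAdicComplete (Ideal.span {(p : integerC F)}) (integerC F)]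
  [CharZero (CompletedAlgClosure F)]

/-! ## §1 `Ŵ(𝔪_{ℂ_F})` and `E₁(ℂ_F)` are `p`-divisible at height one -/

/-- **`Ŵ(𝔪_{ℂ_F})` is `p`-divisible at height one**: if `[Xᵖ][p]_W` maps to a unit of `𝒪_{ℂ_F}` then every `P ∈ Ŵ(𝔪_{ℂ_F})` is `p • Q`
(`[p]_W` is onto, `FormalGroupDivisionHeightOne.exists_evalPt₁_formalMul_prime_eq`; `p • Q = [p]_W(Q)`, `Pt.val_nsmul`).
[cite: SilvermanAEC2009, IV.4.4 and IV.7] -/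
theorem exists_nsmul_prime_eq_pt (hpC : ‖(p : CompletedAlgClosure F)‖ < 1)
    (h1 : IsUnit (algebraMap (LTCoeff F) (CBall F) (PowerSeries.coeff p (W.formalMul p)))) (P : W.Pt (maxNilIdealC F)) :
    ∃ Q : W.Pt (maxNilIdealC F), p • Q = P := by
  obtain ⟨s, hs⟩ := exists_evalPt₁_formalMul_prime_eq hpC W h1 P.val
  exact ⟨⟨s⟩, WeierstrassCurve.Pt.ext (by rw [WeierstrassCurve.Pt.val_nsmul]; exact hs)⟩

/-- The same in the currency `W.Pt (ballNilIdeal ℂ_F)` of the generic dictionary `FormalGroupNilIdealPoints(GroupIso)` (`ptOfZ`, `zPt`, `kernelEquivPt`,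
`ptHom`; `maxNilIdealC F` and `ballNilIdeal ℂ_F` are the same nil ideal). [cite: SilvermanAEC2009, IV.4.4 and IV.7] -/
theorem exists_nsmul_prime_eq_pt' (hpC : ‖(p : CompletedAlgClosure F)‖ < 1)
    (h1 : IsUnit (algebraMap (LTCoeff F) (CBall F) (PowerSeries.coeff p (W.formalMul p)))) (P : W.Pt (ballNilIdeal (CompletedAlgClosure F))) :
    ∃ Q : W.Pt (ballNilIdeal (CompletedAlgClosure F)), p • Q = P :=
  exists_nsmul_prime_eq_pt W hpC h1 P

variable [hE : (curveOver (CompletedAlgClosure F) W).IsElliptic]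

/-- **`E₁(ℂ_F)` is `p`-divisible at height one**: every `X ∈ E₁(ℂ_F)` is `p • Y` with `Y ∈ E₁(ℂ_F)` (transport of `exists_nsmul_prime_eq_pt` along
AEC VII.2.2 `Ŵ(𝔪_{ℂ_F}) ≃ E₁(ℂ_F)`, `kernelEquivPt` / `ptHom`). [cite: SilvermanAEC2009, Prop. VII.2.2 and IV.7] [cite: GreenbergLNM1716, §1 p. 62] -/
theorem exists_mem_kernel_nsmul_prime_eq (hpC : ‖(p : CompletedAlgClosure F)‖ < 1)
    (h1 : IsUnit (algebraMap (LTCoeff F) (CBall F) (PowerSeries.coeff p (W.formalMul p))))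
    {X : (curveOver (CompletedAlgClosure F) W).toAffine.Point}
    (hX : X ∈ kernel (NormedField.valuation (K := CompletedAlgClosure F)) (curveOver (CompletedAlgClosure F) W)) :
    ∃ Y : (curveOver (CompletedAlgClosure F) W).toAffine.Point,
      Y ∈ kernel (NormedField.valuation (K := CompletedAlgClosure F)) (curveOver (CompletedAlgClosure F) W) ∧ p • Y = X := by
  obtain ⟨Q, hQ⟩ := exists_nsmul_prime_eq_pt' W hpC h1 (kernelEquivPt (CompletedAlgClosure F) W ⟨X, hX⟩)
  refine ⟨ptHom (CompletedAlgClosure F) W Q, ?_, ?_⟩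
  · rw [ptHom_apply]; exact ptOfZ_mem_kernel _
  · rw [← map_nsmul, hQ, ptHom_apply, kernelEquivPt_apply_val]
    exact (eq_ptOfZ_zPt hX).symm

/-! ## §2 A `p`-th root in `E(ℂ_F)` of an `F̄`-point is an `F̄`-point -/

omit hE [IsAdicComplete (Ideal.span {(p : integerC F)}) (integerC F)] [CharZero (CompletedAlgClosure F)] in
/-- **`p`-th roots of algebraic points are algebraic**: if `p • Y = ι(P)` in `E(ℂ_F)` for `P ∈ E(F̄)` (`ι = geomToCO`), then `Y = ι(Q)` with
`p • Q = P` — take an algebraic `p`-th root `R` of `P` (`E(F̄)` is divisible); `Y − ι(R)` is `p`-torsion, hence algebraic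
(`exists_mapPointHom_eq_of_zsmul_eq_zero`). [cite: SilvermanAEC2009, III.§7] -/
theorem exists_geomToCO_eq_of_nsmul_eq_geomToCO (hΔ : IsUnit W.Δ) (P : (curveFO F W).geomPoints)
    {Y : (curveOver (CompletedAlgClosure F) W).toAffine.Point} (hY : p • Y = geomToCO W P) :
    ∃ Q : (curveFO F W).geomPoints, geomToCO W Q = Y ∧ p • Q = P := by
  haveI := isElliptic_curveFO (F := F) W hΔ
  haveI := isElliptic_curveBarO (F := F) W hΔ
  have hp : p.Prime := Fact.out
  -- an algebraic `p`-th root `R` of `P`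
  obtain ⟨R, hR⟩ : ∃ R : (curveFO F W).geomPoints, p • R = P :=
    ((curveFO F W).baseChange (AlgebraicClosure F)).nsmul_surjective_of_isAlgClosed hp.ne_zero P
  -- `D = Y − ι(R)` is `p`-torsion in `E(ℂ_F)`, hence algebraic
  set D : (curveOver (CompletedAlgClosure F) W).toAffine.Point := Y - geomToCO W R with hD
  have hpD : (p : ℤ) • D = 0 := by
    rw [natCast_zsmul, hD, nsmul_sub, hY, ← map_nsmul, hR, sub_self]
  -- read `D` over `(W ⊗ F̄) ⊗_{F̄ → ℂ_F} ℂ_F` and use that torsion points are algebraic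
  set D' : ((curveBarO F W).map (algClosureToC F)).toAffine.Point :=
    (WeierstrassCurve.Affine.Point.congrEquiv (curveBarO_map_algClosureToC W)).symm D with hD'
  have hpD' : (p : ℤ) • D' = 0 := by rw [hD', ← map_zsmul, hpD, map_zero]
  have hpne : ((p : ℤ) : AlgebraicClosure F) ≠ 0 := by
    haveI : CharZero (AlgebraicClosure F) := charZero_of_injective_algebraMap (algebraMap F (AlgebraicClosure F)).injective
    exact_mod_cast hp.ne_zero
  obtain ⟨T₀, hT₀, hpT₀⟩ := exists_mapPointHom_eq_of_zsmul_eq_zero (algClosureToC F) (V := curveBarO F W) hpne hpD'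
  -- back to `geomPoints`
  set t : (curveFO F W).geomPoints := (WeierstrassCurve.Affine.Point.congrEquiv (curveFO_baseChange W)).symm T₀ with ht
  have hgt : geomToCO W t = D := by
    change WeierstrassCurve.Affine.Point.congrEquiv (curveBarO_map_algClosureToC W) ((curveBarO F W).mapPointHom (algClosureToC F)
      (WeierstrassCurve.Affine.Point.congrEquiv (curveFO_baseChange W) t)) = D
    rw [ht, AddEquiv.apply_symm_apply, hT₀, hD', AddEquiv.apply_symm_apply]
  have hpt : p • t = 0 := by
    apply geomToCO_injective W
    rw [map_nsmul, hgt, map_zero, ← natCast_zsmul]; exact hpD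
  refine ⟨R + t, ?_, ?_⟩
  · rw [map_add, hgt, hD]; abel
  · rw [smul_add, hR, hpt, add_zero]

/-- ★ **One division step inside `E(F̄) ∩ E₁(ℂ_F)` at height one**: for `P ∈ E(F̄)` whose image lies in `E₁(ℂ_F)` there is `Q ∈ E(F̄)` with
`p • Q = P` and `ι(Q) ∈ E₁(ℂ_F)` (`E₁(ℂ_F)` is `p`-divisible, §1, and the formal `p`-th root is algebraic, §2). [cite: SilvermanAEC2009, Prop. VII.2.2 and III.§7]
[cite: GreenbergLNM1716, §1 p. 62] -/
theorem exists_geom_nsmul_prime_eq_of_geomToCO_mem_kernel (hpC : ‖(p : CompletedAlgClosure F)‖ < 1) (hΔ : IsUnit W.Δ)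
    (h1 : IsUnit (algebraMap (LTCoeff F) (CBall F) (PowerSeries.coeff p (W.formalMul p)))) (P : (curveFO F W).geomPoints)
    (hP : geomToCO W P ∈ kernel (NormedField.valuation (K := CompletedAlgClosure F)) (curveOver (CompletedAlgClosure F) W)) :
    ∃ Q : (curveFO F W).geomPoints, p • Q = P ∧
      geomToCO W Q ∈ kernel (NormedField.valuation (K := CompletedAlgClosure F)) (curveOver (CompletedAlgClosure F) W) := by
  obtain ⟨Y, hYker, hY⟩ := exists_mem_kernel_nsmul_prime_eq W hpC h1 hP
  obtain ⟨Q, hQY, hQ⟩ := exists_geomToCO_eq_of_nsmul_eq_geomToCO W hΔ P hY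
  exact ⟨Q, hQ, hQY ▸ hYker⟩

/-! ## §3 Formal `p`-power division towers of `F̄`-points -/

/-- ★★ **Formal division towers at height one (ORDINARY reduction).** If `[Xᵖ][p]_W` maps to a unit of `𝒪_{ℂ_F}` (`Δ_W ∈ 𝒪_Fˣ`), then every
`P ∈ E(F̄)` with `ι(P) ∈ E₁(ℂ_F)` has a `p`-power division sequence of `F̄`-points `Q : ℕ → E(F̄)`, `Q 0 = P`, `p • Q (n+1) = Q n`, with `ι(Q n) ∈ E₁(ℂ_F)`
for ALL `n` — the data `(Q, hQ, hker)` of `FormalTateModuleInclusion.tateModuleOfPt_kummerCocycleO` (the ordinary replacement of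
`KummerCocycleMatchingO.geomToCO_divSeq_mem_kernel`). [cite: SilvermanAEC2009, Prop. VII.2.2, IV.7 and III.§7] [cite: Tate1967, §4]
[cite: GreenbergLNM1716, §1 p. 62] -/
theorem exists_divSeq_geomToCO_mem_kernel (hpC : ‖(p : CompletedAlgClosure F)‖ < 1) (hΔ : IsUnit W.Δ)
    (h1 : IsUnit (algebraMap (LTCoeff F) (CBall F) (PowerSeries.coeff p (W.formalMul p)))) (P : (curveFO F W).geomPoints)
    (hP : geomToCO W P ∈ kernel (NormedField.valuation (K := CompletedAlgClosure F)) (curveOver (CompletedAlgClosure F) W)) :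
    ∃ Q : ℕ → (curveFO F W).geomPoints, Q 0 = P ∧ (∀ n, p • Q (n + 1) = Q n) ∧
      ∀ n, geomToCO W (Q n) ∈ kernel (NormedField.valuation (K := CompletedAlgClosure F)) (curveOver (CompletedAlgClosure F) W) := by
  -- one step on the subtype of algebraic formal points
  let S := {R : (curveFO F W).geomPoints //
    geomToCO W R ∈ kernel (NormedField.valuation (K := CompletedAlgClosure F)) (curveOver (CompletedAlgClosure F) W)}
  have hstep : ∀ R : S, ∃ R' : S, p • (R' : (curveFO F W).geomPoints) = R := fun R => by
    obtain ⟨Q, hQ, hQker⟩ := exists_geom_nsmul_prime_eq_of_geomToCO_mem_kernel W hpC hΔ h1 R.1 R.2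
    exact ⟨⟨Q, hQker⟩, hQ⟩
  choose f hf using hstep
  let Q : ℕ → S := fun n => Nat.rec (⟨P, hP⟩ : S) (fun _ R => f R) n
  refine ⟨fun n => (Q n).1, rfl, fun n => hf (Q n), fun n => ?_⟩
  exact (Q n).2

/-- **The same from the Hasse datum**: `Δ_W ∈ 𝒪_Fˣ`, `A_p(W mod 𝔪_F) ≠ 0` (ORDINARY reduction, `p` odd = residue characteristic) — `[Xᵖ][p]_W` is then a
unit (`isUnit_algebraMap_coeff_prime_formalMul_of_hasseCoeff_red_ne_zero`). On the K★ (G)-ordinary cells the two inputs are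
`AinfWeierstrassRamifiedCellsWitness.isUnit_Δ_map_model` and `AinfWeierstrassRamifiedCellsOrdinary.hasseCoeff_red_map_model_ne_zero_of_isUnit_cells`.
[cite: SilvermanAEC2009, Prop. VII.2.2, IV.4.4, V.4.1] [cite: GreenbergLNM1716, §1 p. 62] -/
theorem exists_divSeq_geomToCO_mem_kernel_of_hasseCoeff_ne_zero [CharP 𝓀[F] p] (hpC : ‖(p : CompletedAlgClosure F)‖ < 1) (hp2 : p ≠ 2)
    (hΔ : IsUnit W.Δ) (hA : (W.map (redCoeff F)).hasseCoeff p ≠ 0) (P : (curveFO F W).geomPoints)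
    (hP : geomToCO W P ∈ kernel (NormedField.valuation (K := CompletedAlgClosure F)) (curveOver (CompletedAlgClosure F) W)) :
    ∃ Q : ℕ → (curveFO F W).geomPoints, Q 0 = P ∧ (∀ n, p • Q (n + 1) = Q n) ∧
      ∀ n, geomToCO W (Q n) ∈ kernel (NormedField.valuation (K := CompletedAlgClosure F)) (curveOver (CompletedAlgClosure F) W) :=
  exists_divSeq_geomToCO_mem_kernel W hpC hΔ (isUnit_algebraMap_coeff_prime_formalMul_of_hasseCoeff_red_ne_zero W hp2 hA) P hP

end AinfTop

end Literature.NumberTheory.PAdicHodge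

end
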